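/-
Copyright (c) 2026 the pub-hodgecm-mathlib formalisation cell (harness21).  Prover seat hodgecm-mathlib-K2E2-p12 (g6): Track B «K2-LIT», ENGINE E1,
h413 = stmt-HodgeConjecture-24833; line `K2_E1_TraceFormulaBeta`, 5Res campaign «ENDGAME BY FAMILIES», ruling (R) of K2E1-plan (g7) on `K2E1TauSphericalHeckeCommutativeU11`:
the letter `hθη` — AN INVOLUTIVE ANTI-AUTOMORPHIC HOMEOMORPHISM OF A UNIMODULAR LOCALLY COMPACT GROUP PRESERVES HAAR MEASURE (E1: the transpose on `U(1,1) ≤ arch`).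
-/
import Summits.HodgeConjecture.HodgeConjecture.Theorems.K2E1ArchTransposeAntiAutU   -- ★ p860494: `theta_mul_rev`, `theta_theta`, `arch` currency (+ ★ p860461 Gelfand's trick)
import Mathlib.MeasureTheory.Measure.Haar.Unique
import HarnessLib

/-!
# K2·E1 — `K2E1AntiAutHaarPreservingU`: AN INVOLUTIVE ANTI-AUTOMORPHIC HOMEOMORPHISM `θ` OF A LOCALLY COMPACT GROUP WITH AN INVERSION-INVARIANT HAAR MEASURE `μ` IS MEASURE-PRESERVING
# (`hθη` of ★ p860461 ∕ p860494; E1: `θ = ᵀ` on `arch`) [Weil 1940 §8; Deitmar–Echterhoff Thm. 1.3.4, Prop. 1.8; Helgason GGA IV §3]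

Track B ∕ K2-LIT, crux h413 = `stmt-HodgeConjecture-24833`, route of record `HCCMUnconditional`; cell `hodgecm-mathlib`, squad K2, ENGINE E1 (5Res campaign, M2 v2 §3′.1, the `hcommTau` road:
★ p860461 Gelfand's trick takes `hθη : MeasurePreserving θ η η`; this file DISCHARGES it for every involutive anti-automorphic homeomorphism and every inversion-invariant Haar `η` —
unimodular groups, in particular the reductive `U(1,1) ≤ arch`).  THEOREMS ONLY (no `def`, no `instance`, no notation, no named-fact hypothesis, no `sorry`; default heartbeats); lane
`--supports stmt-HodgeConjecture-24833 --as helper` (count-neutral).  CLOSES NO SOCKET.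

THE ARGUMENT.  `φ(x) := (θ x)⁻¹` is a continuous multiplicative AUTOMORPHISM (`(θ(xy))⁻¹ = (θy·θx)⁻¹ = (θx)⁻¹(θy)⁻¹`), again an involution; so `φ_* μ` is a Haar measure (Mathlib
`ContinuousMulEquiv.isHaarMeasure_map`) and `φ_* μ = c • μ` (Haar uniqueness, Mathlib `isMulLeftInvariant_eq_smul`, `c = haarScalarFactor`); `φ ∘ φ = id` gives `c · c = 1` (Mathlib
`haarScalarFactor_map`, `haarScalarFactor_eq_mul`, `haarScalarFactor_self`), so `c = 1` and `φ_* μ = μ`; finally `θ = inv ∘ φ` and `μ` is inversion-invariant, so `θ_* μ = μ`.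
* §1 `exists_continuousMulEquiv_of_antiAut` — the automorphism `φ = inv ∘ θ` as a `ContinuousMulEquiv` with `φ x = (θ x)⁻¹`; `haarScalarFactor_eq_one_of_involutive` — an involutive `G ≃ₜ* G` has Haar
  scalar factor `1`; `map_eq_self_of_involutive` — hence preserves every Haar measure; **`measurePreserving_of_antiAut`** — the statement above.
* §2 E1: **`measurePreserving_theta_unitaryGroupOfForm`** ∕ **`measurePreserving_theta_arch`** — for any `θ` on `U(J)` ∕ `arch F E c N J` with `(θ g : Matrix) = (g : Matrix)ᵀ` (★ p860494 `hθT`,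
  `theta_mul_rev`, `theta_theta`) and any inversion-invariant Haar measure `η`: `MeasurePreserving θ η η` — the letter `hθη` of ★ p860494 `integratedOperator_arch_comm_of_spherical` DISCHARGED;
  **`integratedOperator_arch_comm_of_spherical'`** — the arch print with `hθη` removed (only `hKconj` remains a letter).
HONEST LABEL: HC_CM is proved only modulo the 7 printed citations (2 remaining named inputs: hLiu418 = `stmt-HodgeConjecture-24832`, h413 = `stmt-HodgeConjecture-24833`) until rung 0
closes; this file asserts no named fact and closes no socket; count-neutral; unconditional.

## References
* [DeitmarEchterhoff2014] A. Deitmar, S. Echterhoff, *Principles of Harmonic Analysis* (2nd ed., 2014): Thm. 1.3.4 (uniqueness of Haar measure), Prop. 1.8 ff. (modular function; unimodular groups).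
* [Helgason2000] S. Helgason, *Groups and Geometric Analysis* (AMS 2000): Ch. IV §3, Thm. 3.1 (the anti-automorphism preserves `dg`).
* [Knapp1986] A. W. Knapp, *Representation Theory of Semisimple Groups* (1986): VIII §3.
-/

set_option autoImplicit false
set_option linter.dupNamespace false -- the mandated namespace repeats `HodgeConjecture.HodgeConjecture`

noncomputable section

open MeasureTheory MeasureTheory.Measure Filter Topology CompactlySupported NumberField NumberField.mixedEmbedding
open Literature.NumberTheory.Automorphic Literature.NumberTheory.Automorphic.UnitaryGroup
open Summit.HodgeConjecture.HodgeConjecture.Cruxes.H413.K2E1ArchTransposeAntiAutU (theta_mul_rev theta_theta integratedOperator_arch_comm_of_spherical)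
open scoped Matrix

namespace Summit.HodgeConjecture.HodgeConjecture.Cruxes.H413.K2E1AntiAutHaarPreservingU

/-! ## §1 Generic: involutive anti-automorphisms preserve inversion-invariant Haar measures -/

section Generic

variable {G : Type*} [Group G] [TopologicalSpace G] [IsTopologicalGroup G] [MeasurableSpace G] [BorelSpace G]

omit [MeasurableSpace G] [BorelSpace G] in
/-- **`φ = inv ∘ θ` IS A CONTINUOUS MULTIPLICATIVE AUTOMORPHISM** for an anti-automorphic homeomorphism `θ`: there is `φ : G ≃ₜ* G` with `φ x = (θ x)⁻¹`. [cite: Helgason2000, Ch. IV §3 Thm. 3.1] -/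
theorem exists_continuousMulEquiv_of_antiAut (θ : G ≃ₜ G) (hθmul : ∀ x y : G, θ (x * y) = θ y * θ x) :
    ∃ φ : G ≃ₜ* G, ∀ x, φ x = (θ x)⁻¹ := by
  refine ⟨{ toFun := fun x => (θ x)⁻¹, invFun := fun y => θ.symm y⁻¹,
            left_inv := fun x => by simp only [inv_inv, Homeomorph.symm_apply_apply],
            right_inv := fun y => by simp only [Homeomorph.apply_symm_apply, inv_inv],
            map_mul' := fun x y => by simp only [hθmul, mul_inv_rev],
            continuous_toFun := θ.continuous.inv,
            continuous_invFun := θ.symm.continuous.comp continuous_inv }, fun x => rfl⟩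

/-- **AN INVOLUTIVE CONTINUOUS AUTOMORPHISM HAS HAAR SCALAR FACTOR `1`**: for a Haar measure `μ` and `φ : G ≃ₜ* G` with `φ ∘ φ = id`, `haarScalarFactor (φ_* μ) μ = 1`
(`c := haarScalarFactor (φ_*μ) μ` satisfies `c · c = haarScalarFactor μ μ = 1` by Mathlib `haarScalarFactor_map` and `haarScalarFactor_eq_mul`). [cite: DeitmarEchterhoff2014, Thm. 1.3.4] -/
theorem haarScalarFactor_eq_one_of_involutive [LocallyCompactSpace G] (μ : Measure G) [IsHaarMeasure μ] (φ : G ≃ₜ* G) (hφφ : ∀ x, φ (φ x) = x) :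
    haarScalarFactor (map φ μ) μ = 1 := by
  have hφm : Measurable (φ : G → G) := φ.continuous.measurable
  have hmm : map φ (map φ μ) = μ := by
    rw [map_map hφm hφm]
    have : ((φ : G → G) ∘ (φ : G → G)) = id := funext hφφ
    rw [this, Measure.map_id]
  -- `c' := haarScalarFactor μ (map φ μ) = haarScalarFactor (map φ (map φ μ)) (map φ μ) = c`
  have h1 : haarScalarFactor μ (map φ μ) = haarScalarFactor (map φ μ) μ := by
    have h := haarScalarFactor_map (map φ μ) μ φ
    simp only [hmm] at h
    exact h
  -- `1 = haarScalarFactor μ μ = c' * c = c * c`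
  have h2 : haarScalarFactor μ (map φ μ) * haarScalarFactor (map φ μ) μ = 1 := by
    rw [← haarScalarFactor_eq_mul μ (map φ μ) μ, haarScalarFactor_self]
  rw [h1] at h2
  have h3 : ((haarScalarFactor (map φ μ) μ : NNReal) : ℝ) * (haarScalarFactor (map φ μ) μ : ℝ) = 1 := by exact_mod_cast h2
  rcases mul_self_eq_one_iff.mp h3 with h | h
  · exact_mod_cast h
  · exfalso
    have h0 : (0 : ℝ) ≤ (haarScalarFactor (map φ μ) μ : ℝ) := (haarScalarFactor (map φ μ) μ).2
    rw [h] at h0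
    norm_num at h0

/-- **AN INVOLUTIVE CONTINUOUS AUTOMORPHISM PRESERVES EVERY HAAR MEASURE** (second countable locally compact `G`): `φ_* μ = μ`. [cite: DeitmarEchterhoff2014, Thm. 1.3.4] -/
theorem map_eq_self_of_involutive [LocallyCompactSpace G] [SecondCountableTopology G] (μ : Measure G) [IsHaarMeasure μ] (φ : G ≃ₜ* G) (hφφ : ∀ x, φ (φ x) = x) :
    map φ μ = μ := by
  have h := isMulLeftInvariant_eq_smul (map φ μ) μ
  rw [haarScalarFactor_eq_one_of_involutive μ φ hφφ, one_smul] at h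
  exact h

/-- **AN INVOLUTIVE ANTI-AUTOMORPHIC HOMEOMORPHISM PRESERVES AN INVERSION-INVARIANT HAAR MEASURE**: `θ (x y) = θ y · θ x`, `θ ∘ θ = id`, `μ` Haar with `μ(A⁻¹) = μ(A)` (unimodular `G`) ⇒
`MeasurePreserving θ μ μ` (`θ = inv ∘ φ` with `φ` an involutive continuous automorphism: `θ_* μ = inv_* φ_* μ = inv_* μ = μ`) — the letter `hθη` of ★ p860461 ∕ p860494.
[cite: Helgason2000, Ch. IV §3 Thm. 3.1] [cite: DeitmarEchterhoff2014, Thm. 1.3.4] -/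
theorem measurePreserving_of_antiAut [LocallyCompactSpace G] [SecondCountableTopology G] (μ : Measure G) [IsHaarMeasure μ] [μ.IsInvInvariant]
    (θ : G ≃ₜ G) (hθmul : ∀ x y : G, θ (x * y) = θ y * θ x) (hθθ : ∀ x, θ (θ x) = x) : MeasurePreserving θ μ μ := by
  obtain ⟨φ, hφ⟩ := exists_continuousMulEquiv_of_antiAut θ hθmul
  have hθ1 : θ 1 = 1 := K2E1TauSphericalHeckeCommutativeU11.theta_one θ hθmul
  have hθinv : ∀ x, θ x⁻¹ = (θ x)⁻¹ := K2E1TauSphericalHeckeCommutativeU11.theta_inv θ hθmul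
  have hφφ : ∀ x, φ (φ x) = x := fun x => by rw [hφ, hφ, hθinv, inv_inv, hθθ]
  have hθeq : (θ : G → G) = (fun x : G => x⁻¹) ∘ (φ : G → G) := funext fun x => by rw [Function.comp_apply, hφ, inv_inv]
  have hφm : Measurable (φ : G → G) := φ.continuous.measurable
  refine ⟨θ.continuous.measurable, ?_⟩
  rw [hθeq, ← map_map measurable_inv hφm, map_eq_self_of_involutive μ φ hφφ, map_inv_eq_self]

end Generic

/-! ## §2 E1: the transpose on `U(J)` ∕ `arch` preserves Haar measure; the arch print with `hθη` discharged -/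

section UnitaryForm

variable {R : Type*} [CommRing R] [TopologicalSpace R] [IsTopologicalRing R] {N : ℕ} {σ : R →+* R} {J : Matrix (Fin N) (Fin N) R}

omit [IsTopologicalRing R] in
/-- **THE TRANSPOSE ON `U(J) ≤ GL_N(R)` PRESERVES HAAR MEASURE** (any `θ` with `(θ g : Matrix) = (g : Matrix)ᵀ`; `U(J)` locally compact second countable as a topological group, `η` an
inversion-invariant Haar measure). [cite: Helgason2000, Ch. IV §3 Thm. 3.1] -/
theorem measurePreserving_theta_unitaryGroupOfForm [IsTopologicalGroup ↥(unitaryGroupOfForm σ J)] [LocallyCompactSpace ↥(unitaryGroupOfForm σ J)] [SecondCountableTopology ↥(unitaryGroupOfForm σ J)]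
    [MeasurableSpace ↥(unitaryGroupOfForm σ J)] [BorelSpace ↥(unitaryGroupOfForm σ J)]
    (θ : ↥(unitaryGroupOfForm σ J) ≃ₜ ↥(unitaryGroupOfForm σ J))
    (hθT : ∀ g : ↥(unitaryGroupOfForm σ J), (((θ g : ↥(unitaryGroupOfForm σ J)) : GL (Fin N) R) : Matrix (Fin N) (Fin N) R) = (((g : GL (Fin N) R) : Matrix (Fin N) (Fin N) R))ᵀ)
    (η : Measure ↥(unitaryGroupOfForm σ J)) [IsHaarMeasure η] [η.IsInvInvariant] : MeasurePreserving θ η η :=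
  measurePreserving_of_antiAut η θ (theta_mul_rev θ hθT) (theta_theta θ hθT)

end UnitaryForm

section Arch

variable (F E : Type) [Field F] [Field E] [NumberField E] [Algebra F E] (c : E ≃ₐ[F] E) (N : ℕ) (J : Matrix (Fin N) (Fin N) E)

/-- **THE TRANSPOSE ON `arch F E c N J = U(J)(E ⊗ ℝ)` PRESERVES EVERY INVERSION-INVARIANT HAAR MEASURE** — the letter `hθη` of ★ p860494 `integratedOperator_arch_comm_of_spherical` DISCHARGED (★
`instLocallyCompactSpaceArch`, `instSecondCountableTopologyArch`, `instIsTopologicalGroupArch`). [cite: Helgason2000, Ch. IV §3 Thm. 3.1] [cite: DeitmarEchterhoff2014, Thm. 1.3.4] -/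
theorem measurePreserving_theta_arch [MeasurableSpace ↥(arch F E c N J)] [BorelSpace ↥(arch F E c N J)]
    (θ : ↥(arch F E c N J) ≃ₜ ↥(arch F E c N J))
    (hθT : ∀ g : ↥(arch F E c N J), (((θ g : ↥(arch F E c N J)) : GL (Fin N) (mixedSpace E)) : Matrix (Fin N) (Fin N) (mixedSpace E)) =
      (((g : GL (Fin N) (mixedSpace E)) : Matrix (Fin N) (Fin N) (mixedSpace E)))ᵀ)
    (η : Measure ↥(arch F E c N J)) [IsHaarMeasure η] [η.IsInvInvariant] : MeasurePreserving θ η η :=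
  measurePreserving_of_antiAut η θ (theta_mul_rev θ hθT) (theta_theta θ hθT)

/-- **THE ARCH PRINT OF GELFAND'S TRICK WITH `hθη` DISCHARGED**: for `θ` with `(θ g : Matrix) = (g : Matrix)ᵀ`, an inversion-invariant Haar measure `η` on `arch`, `κ : K →* arch` with
multiplicative `χ`, and the one remaining LETTER `hKconj : ∀ g, ∃ k, θ g = κ k * g * (κ k)⁻¹`: `σ(f₁) ∘ σ(f₂) = σ(f₂) ∘ σ(f₁)` for every unitary strongly continuous `σ` of `arch` and `χ`-spherical
`f₁, f₂ ∈ C_c(arch)` (★ p860494 + §1). [cite: Helgason2000, Ch. IV §3 Thm. 3.1] [cite: Knapp1986, VIII §3] -/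
theorem integratedOperator_arch_comm_of_spherical' [MeasurableSpace ↥(arch F E c N J)] [BorelSpace ↥(arch F E c N J)]
    (θ : ↥(arch F E c N J) ≃ₜ ↥(arch F E c N J))
    (hθT : ∀ g : ↥(arch F E c N J), (((θ g : ↥(arch F E c N J)) : GL (Fin N) (mixedSpace E)) : Matrix (Fin N) (Fin N) (mixedSpace E)) =
      (((g : GL (Fin N) (mixedSpace E)) : Matrix (Fin N) (Fin N) (mixedSpace E)))ᵀ)
    (η : Measure ↥(arch F E c N J)) [IsHaarMeasure η] [η.IsInvInvariant] [SFinite η]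
    {K : Type*} [Group K] (κ : K →* ↥(arch F E c N J)) (χ : K → ℂ) (hχmul : ∀ k l, χ (k * l) = χ k * χ l) (hχone : χ 1 = 1)
    (hKconj : ∀ g : ↥(arch F E c N J), ∃ k : K, θ g = κ k * g * (κ k)⁻¹)
    {V : Type*} [NormedAddCommGroup V] [InnerProductSpace ℂ V] [CompleteSpace V] (ρ : ContRepresentation ℂ ↥(arch F E c N J) V) (hu : ρ.IsUnitary) (hc' : ρ.IsStronglyContinuous)
    (f₁ f₂ : C_c(↥(arch F E c N J), ℂ))
    (h₁l : ∀ (k : K) (x : ↥(arch F E c N J)), f₁ (κ k * x) = χ k * f₁ x) (h₁r : ∀ (k : K) (x : ↥(arch F E c N J)), f₁ (x * κ k) = χ k * f₁ x)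
    (h₂l : ∀ (k : K) (x : ↥(arch F E c N J)), f₂ (κ k * x) = χ k * f₂ x) (h₂r : ∀ (k : K) (x : ↥(arch F E c N J)), f₂ (x * κ k) = χ k * f₂ x) :
    ρ.integratedOperator hu hc' η f₁ ∘L ρ.integratedOperator hu hc' η f₂ = ρ.integratedOperator hu hc' η f₂ ∘L ρ.integratedOperator hu hc' η f₁ :=
  integratedOperator_arch_comm_of_spherical F E c N J θ hθT η (measurePreserving_theta_arch F E c N J θ hθT η) κ χ hχmul hχone hKconj ρ hu hc' f₁ f₂ h₁l h₁r h₂l h₂r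

end Arch

end Summit.HodgeConjecture.HodgeConjecture.Cruxes.H413.K2E1AntiAutHaarPreservingU

end
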